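import Summits.ValiantsHypothesis.ValiantsHypothesis.Theorems.KPlusLogSqLawTropicalBFreshExchanges

/-!
# ValiantsHypothesis / LacunarySymmetroid — crux `MatrixDescartes` (stmt-ValiantsHypothesis-18050, V1): the MONOTONE CYCLE LAW
# (idea card `cycle-monotone-codes`, val-idea-23 (d); director-valiant R271 (1) deliverable D1; crit-6 VERDICT #9 PASS-WITH-PRICE as a LAW)

Filed by val-sym-trop-p4 (g16) as the named hand (`--supports stmt-ValiantsHypothesis-18050 --as helper`), from val-idea-23's staged
bytes `pub/ideators/val-idea-23/{Sketch.lean, DoorMCL.lean}` (farm rc 0 by crit-6), DEF-FREE: the card's `cost`/`slope`/`IsOptAt`/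
`MonotoneCycleLaw` are unfolded in the statements (so the Cruxes sketch closes its copies by `exact`), and the door version is derived
from the tree's cyclewise-monotonicity lemma `KPlusLogSqLaw.sum_d_lt_of_isDominant_invariant` (val-sym-trop-p4 g2 / conjb-2 g4) instead
of being re-proved.

* `exists_switch` — the `U`-switched permutation `σ₂|U ∪ σ₁|Uᶜ` exists when `σ₁ '' U = σ₂ '' U`.
* `monotoneCycleLaw_holds` — **MCL, abstract real form**: for cell costs `A` and cell slopes `D` on `Fin N`, if `σ₁` maximises
  `cost + θ₁·slope` and `σ₂` maximises `cost + θ₂·slope` with `θ₁ < θ₂`, then on every common invariant row set `U`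
  (`U.image σ₁ = U.image σ₂`) the slope carried by `σ₂` is at least that carried by `σ₁`.  Scale-free, pairwise, any real slopes.
* `door_mcl` — **MCL at the tropical door** (the cell's dominance designs `(d, v, ε)`, `IsDominant` of
  `…MatrixDescartesFalseOfTropicalMonster`): two dominant terms at `θ₁ < θ₂` are cycle-monotone on every common invariant row set
  (non-strict form; the strict form when the terms differ on `U` is the tree lemma).

HONEST FRAMING.  A structure LAW valid for every design (a necessary condition on upper-hull families / `TropicalMonster` witnesses);
it bounds nothing by itself: `MatrixDescartes` (18050), `TropicalB` (19771), Conjecture B and `VP ≠ VNP` stay OPEN / NOT proved.  The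
card's C2 («products collapse to chains») is not typed here (card rev 2 pending).  No definitions, no named facts.
-/

set_option linter.dupNamespace false
set_option autoImplicit false

namespace Summit.ValiantsHypothesis.ValiantsHypothesis.Theorems.LacunarySymmetroidMatrixDescartes
namespace MonotoneCycleLaw

open Finset
open scoped BigOperators
open Summit.ValiantsHypothesis.ValiantsHypothesis.Theorems.MatrixDescartes.Negative

/-- The switched permutation: `σ₂` on `U`, `σ₁` off `U` (a permutation because the images of `U` agree).
[val-idea-23, `Sketch.lean`; folklore] -/
theorem exists_switch {N : ℕ} (σ₁ σ₂ : Equiv.Perm (Fin N)) (U : Finset (Fin N))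
    (hU : U.image σ₁ = U.image σ₂) :
    ∃ σ₃ : Equiv.Perm (Fin N), (∀ i ∈ U, σ₃ i = σ₂ i) ∧ (∀ i ∉ U, σ₃ i = σ₁ i) := by
  classical
  let g : Fin N → Fin N := fun i => if i ∈ U then σ₂ i else σ₁ i
  have ginj : Function.Injective g := by
    intro i j hij
    change (if i ∈ U then σ₂ i else σ₁ i) = (if j ∈ U then σ₂ j else σ₁ j) at hij
    by_cases hi : i ∈ U <;> by_cases hj : j ∈ U
    · rw [if_pos hi, if_pos hj] at hij; exact σ₂.injective hij
    · rw [if_pos hi, if_neg hj] at hij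
      exfalso
      have hmem : σ₂ i ∈ U.image σ₂ := Finset.mem_image_of_mem _ hi
      rw [← hU, hij] at hmem
      obtain ⟨k, hk, hkj⟩ := Finset.mem_image.mp hmem
      exact hj (σ₁.injective hkj ▸ hk)
    · rw [if_neg hi, if_pos hj] at hij
      exfalso
      have hmem : σ₂ j ∈ U.image σ₂ := Finset.mem_image_of_mem _ hj
      rw [← hU, ← hij] at hmem
      obtain ⟨k, hk, hki⟩ := Finset.mem_image.mp hmem
      exact hi (σ₁.injective hki ▸ hk)
    · rw [if_neg hi, if_neg hj] at hij; exact σ₁.injective hij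
  refine ⟨Equiv.ofBijective g (Finite.injective_iff_bijective.mp ginj), ?_, ?_⟩
  · intro i hi; simp [g, hi]
  · intro i hi; simp [g, hi]

/-- **MONOTONE CYCLE LAW (abstract real form; = the card's `MonotoneCycleLaw` with `cost`, `slope`, `IsOptAt` unfolded).**  If `σ₁`
maximises `∑ A i (τ i) + θ₁·∑ D i (τ i)` and `σ₂` maximises the same at `θ₂ > θ₁`, then `∑_{i∈U} D i (σ₁ i) ≤ ∑_{i∈U} D i (σ₂ i)`
for every `U` with `U.image σ₁ = U.image σ₂`.  Proof: the two `U`-switched permutations have the same total cost and total slope as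
`σ₁, σ₂` together; optimality at `θ₁` and at `θ₂` then gives `(θ₂ − θ₁)·(switched slope − slope σ₁) ≥ 0`.
[val-idea-23 (d), `Sketch.lean` `monotoneCycleLaw_holds`; folklore exchange argument] -/
theorem monotoneCycleLaw_holds :
    ∀ (N : ℕ) (A D : Fin N → Fin N → ℝ) (θ₁ θ₂ : ℝ), θ₁ < θ₂ →
    ∀ (σ₁ σ₂ : Equiv.Perm (Fin N)),
      (∀ τ : Equiv.Perm (Fin N), (∑ i, A i (τ i)) + θ₁ * ∑ i, D i (τ i) ≤ (∑ i, A i (σ₁ i)) + θ₁ * ∑ i, D i (σ₁ i)) →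
      (∀ τ : Equiv.Perm (Fin N), (∑ i, A i (τ i)) + θ₂ * ∑ i, D i (τ i) ≤ (∑ i, A i (σ₂ i)) + θ₂ * ∑ i, D i (σ₂ i)) →
      ∀ U : Finset (Fin N), U.image σ₁ = U.image σ₂ →
        ∑ i ∈ U, D i (σ₁ i) ≤ ∑ i ∈ U, D i (σ₂ i) := by
  intro N A D θ₁ θ₂ hθ σ₁ σ₂ h₁ h₂ U hU
  classical
  obtain ⟨σ₃, h3U, h3c⟩ := exists_switch σ₁ σ₂ U hU
  obtain ⟨σ₄, h4U, h4c⟩ := exists_switch σ₂ σ₁ U hU.symm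
  have key : ∀ F : Fin N → Fin N → ℝ,
      ∑ i, F i (σ₃ i) + ∑ i, F i (σ₄ i) = ∑ i, F i (σ₁ i) + ∑ i, F i (σ₂ i) := by
    intro F
    rw [← Finset.sum_add_distrib, ← Finset.sum_add_distrib]
    apply Finset.sum_congr rfl
    intro i _
    by_cases hi : i ∈ U
    · rw [h3U i hi, h4U i hi, add_comm]
    · rw [h3c i hi, h4c i hi]
  have kc := key A
  have ks := key D
  have hvan : ∀ x ∈ (Finset.univ : Finset (Fin N)), x ∉ U → (D x (σ₃ x) - D x (σ₁ x)) = 0 := by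
    intro x _ hx; rw [h3c x hx]; exact sub_self _
  have hs3 : (∑ i, D i (σ₃ i)) - ∑ i, D i (σ₁ i) = ∑ i ∈ U, (D i (σ₂ i) - D i (σ₁ i)) := by
    rw [← Finset.sum_sub_distrib, ← Finset.sum_subset (Finset.subset_univ U) hvan]
    exact Finset.sum_congr rfl (fun i hi => by rw [h3U i hi])
  rw [Finset.sum_sub_distrib] at hs3
  have e1 := h₁ σ₃
  have e2 := h₂ σ₄
  have ks2 : θ₂ * ∑ i, D i (σ₃ i) + θ₂ * ∑ i, D i (σ₄ i) = θ₂ * ∑ i, D i (σ₁ i) + θ₂ * ∑ i, D i (σ₂ i) := by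
    rw [← mul_add, ← mul_add, ks]
  have e3 : (∑ i, A i (σ₁ i)) + θ₂ * ∑ i, D i (σ₁ i) ≤ (∑ i, A i (σ₃ i)) + θ₂ * ∑ i, D i (σ₃ i) := by linarith [e2, kc, ks2]
  have hpos : 0 < θ₂ - θ₁ := sub_pos.mpr hθ
  have e5 : 0 ≤ (∑ i, D i (σ₃ i)) - ∑ i, D i (σ₁ i) := by
    by_contra hneg
    push Not at hneg
    have hprod := mul_neg_of_pos_of_neg hpos hneg
    nlinarith [e1, e3, hprod]
  linarith [e5, hs3]

/-- **MCL AT THE DOOR** (val-idea-23 `door_mcl`, statement verbatim).  For ONE tropical design `(d, v, ε)`: if the term `p₁` is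
dominant at `θ₁` and `p₂` at `θ₂ > θ₁`, then for every row set `U` with `U.image p₁.1 = U.image p₂.1`,
`∑_{i ∈ U} d (p₁.2 i) ≤ ∑_{i ∈ U} d (p₂.2 i)`; in particular every pair of terms of a `TropicalMonster` witness is cycle-monotone.
Derived from the tree's STRICT form `KPlusLogSqLaw.sum_d_lt_of_isDominant_invariant` (if the two terms differ anywhere on `U` the
inequality is strict; otherwise the two sums coincide), through the landed dictionary `KPlusLogSqLaw.invariant_of_image_eq`
(`U.image σ₁ = U.image σ₂` ⇒ `U` invariant under `σ₁⁻¹σ₂`). [val-idea-23 (d); tree lemmas val-sym-trop-p4 g2 / conjb-2 g4] -/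
theorem door_mcl {m K : ℕ} (d : Fin K → ℕ) (v ε : Fin m → Fin m → Fin K → ℤ) {θ₁ θ₂ : ℤ} (hθ : θ₁ < θ₂)
    {p₁ p₂ : Equiv.Perm (Fin m) × (Fin m → Fin K)}
    (h₁ : IsDominant d v ε θ₁ p₁) (h₂ : IsDominant d v ε θ₂ p₂)
    (U : Finset (Fin m)) (hU : U.image p₁.1 = U.image p₂.1) :
    ∑ i ∈ U, (d (p₁.2 i) : ℤ) ≤ ∑ i ∈ U, (d (p₂.2 i) : ℤ) := by
  obtain ⟨σ₁, l₁⟩ := p₁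
  obtain ⟨σ₂, l₂⟩ := p₂
  dsimp only at hU ⊢
  have hT := KPlusLogSqLaw.invariant_of_image_eq σ₁ σ₂ U hU
  by_cases hne : ∃ b ∈ U, σ₁ b ≠ σ₂ b ∨ l₁ b ≠ l₂ b
  · exact (KPlusLogSqLaw.sum_d_lt_of_isDominant_invariant d v ε hθ h₁ h₂ U hT hne).le
  · push Not at hne
    exact (Finset.sum_congr rfl fun i hi => by rw [(hne i hi).2]).le

/-! ## APPENDED 2026-08-28 (val-sym-trop-p4 g16, append-only): val-idea-23's card rev 2 corollaries C2 / C2′ VERBATIM from the staged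
bytes `pub/ideators/val-idea-23/stage/LacunarySymmetroidMatrixDescartesMonotoneCycleLaw.lean` (sha16 c8189a76c61f9f12, crit-6 READ ✓ 16:08Z),
with the card's `monotoneCycleLaw` read as this file's `monotoneCycleLaw_holds` (same statement, def-free).  HONEST FRAMING as above: corollaries
of a law already in the tree since 2026-08-26 (`KPlusLogSqLaw.sum_d_lt_of_isDominant_invariant`, crit-6 ADDENDUM to VERDICT #9: novelty grade
VARIANT); nothing on `MatrixDescartes`, `TropicalB`, Conjecture B or VP ≠ VNP. -/

/-! ## C2 — gadgets switch at most once; products collapse to chains -/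

/-- A finset mapped into itself by a permutation is mapped onto itself. [folklore; val-idea-23] -/
theorem image_eq_of_mapsTo {N : ℕ} (σ : Equiv.Perm (Fin N)) (U : Finset (Fin N))
    (h : ∀ i ∈ U, σ i ∈ U) : U.image σ = U := by
  classical
  apply Finset.eq_of_subset_of_card_le
  · intro x hx
    obtain ⟨i, hi, rfl⟩ := Finset.mem_image.mp hx
    exact h i hi
  · rw [Finset.card_image_of_injective U σ.injective]

/-- A finset fixed pointwise by a permutation is mapped onto itself. [folklore; val-idea-23] -/
theorem image_eq_of_fixes {N : ℕ} (σ : Equiv.Perm (Fin N)) (U : Finset (Fin N))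
    (h : ∀ i ∈ U, σ i = i) : U.image σ = U :=
  image_eq_of_mapsTo σ U (fun i hi => by rw [h i hi]; exact hi)

/-- **C2a.** A gadget (row set `U`) that is ON in the `θ₁`-optimum (`σ₁` acts inside `U`) and OFF in the `θ₂`-optimum
(`σ₂` is the identity on `U`), `θ₁ < θ₂`, carries at most the diagonal slope: turning it on did not increase slope. -/
theorem gadget_on_off {N : ℕ} (A D : Fin N → Fin N → ℝ) {θ₁ θ₂ : ℝ} (hθ : θ₁ < θ₂)
    (σ₁ σ₂ : Equiv.Perm (Fin N))
    (h₁ : ∀ τ : Equiv.Perm (Fin N),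
      ∑ i, A i (τ i) + θ₁ * ∑ i, D i (τ i) ≤ ∑ i, A i (σ₁ i) + θ₁ * ∑ i, D i (σ₁ i))
    (h₂ : ∀ τ : Equiv.Perm (Fin N),
      ∑ i, A i (τ i) + θ₂ * ∑ i, D i (τ i) ≤ ∑ i, A i (σ₂ i) + θ₂ * ∑ i, D i (σ₂ i))
    (U : Finset (Fin N)) (hon : ∀ i ∈ U, σ₁ i ∈ U) (hoff : ∀ i ∈ U, σ₂ i = i) :
    ∑ i ∈ U, D i (σ₁ i) ≤ ∑ i ∈ U, D i i := by
  have hU : U.image σ₁ = U.image σ₂ := by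
    rw [image_eq_of_mapsTo σ₁ U hon, image_eq_of_fixes σ₂ U hoff]
  calc ∑ i ∈ U, D i (σ₁ i) ≤ ∑ i ∈ U, D i (σ₂ i) := monotoneCycleLaw_holds _ A D _ _ hθ σ₁ σ₂ h₁ h₂ U hU
    _ = ∑ i ∈ U, D i i := Finset.sum_congr rfl (fun i hi => by rw [hoff i hi])

/-- **C2b.** Symmetrically: OFF at `θ₁`, ON at `θ₂ > θ₁` ⇒ the gadget's slope on `U` is at least the diagonal slope. -/
theorem gadget_off_on {N : ℕ} (A D : Fin N → Fin N → ℝ) {θ₁ θ₂ : ℝ} (hθ : θ₁ < θ₂)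
    (σ₁ σ₂ : Equiv.Perm (Fin N))
    (h₁ : ∀ τ : Equiv.Perm (Fin N),
      ∑ i, A i (τ i) + θ₁ * ∑ i, D i (τ i) ≤ ∑ i, A i (σ₁ i) + θ₁ * ∑ i, D i (σ₁ i))
    (h₂ : ∀ τ : Equiv.Perm (Fin N),
      ∑ i, A i (τ i) + θ₂ * ∑ i, D i (τ i) ≤ ∑ i, A i (σ₂ i) + θ₂ * ∑ i, D i (σ₂ i))
    (U : Finset (Fin N)) (hoff : ∀ i ∈ U, σ₁ i = i) (hon : ∀ i ∈ U, σ₂ i ∈ U) :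
    ∑ i ∈ U, D i i ≤ ∑ i ∈ U, D i (σ₂ i) := by
  have hU : U.image σ₁ = U.image σ₂ := by
    rw [image_eq_of_fixes σ₁ U hoff, image_eq_of_mapsTo σ₂ U hon]
  calc ∑ i ∈ U, D i i = ∑ i ∈ U, D i (σ₁ i) := Finset.sum_congr rfl (fun i hi => by rw [hoff i hi])
    _ ≤ ∑ i ∈ U, D i (σ₂ i) := monotoneCycleLaw_holds _ A D _ _ hθ σ₁ σ₂ h₁ h₂ U hU

/-- **C2 (products collapse to chains).** A gadget with POSITIVE slope increment that is ON at `θ₁` is never OFF at any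
`θ₂ > θ₁`: ON-sets of hull members grow with `θ`, so the hull meets the `2^k` products of `k` disjoint positive gadgets in a
chain of at most `k + 1` members. -/
theorem gadget_stays_on {N : ℕ} (A D : Fin N → Fin N → ℝ) {θ₁ θ₂ : ℝ} (hθ : θ₁ < θ₂)
    (σ₁ σ₂ : Equiv.Perm (Fin N))
    (h₁ : ∀ τ : Equiv.Perm (Fin N),
      ∑ i, A i (τ i) + θ₁ * ∑ i, D i (τ i) ≤ ∑ i, A i (σ₁ i) + θ₁ * ∑ i, D i (σ₁ i))
    (h₂ : ∀ τ : Equiv.Perm (Fin N),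
      ∑ i, A i (τ i) + θ₂ * ∑ i, D i (τ i) ≤ ∑ i, A i (σ₂ i) + θ₂ * ∑ i, D i (σ₂ i))
    (U : Finset (Fin N)) (hon : ∀ i ∈ U, σ₁ i ∈ U) (hinc : ∑ i ∈ U, D i i < ∑ i ∈ U, D i (σ₁ i)) :
    ¬ (∀ i ∈ U, σ₂ i = i) := fun hoff =>
  absurd (gadget_on_off A D hθ σ₁ σ₂ h₁ h₂ U hon hoff) (not_le.mpr hinc)

/-- **C2, negative-increment form.** A gadget with NEGATIVE increment that is OFF at `θ₁` is never ON at `θ₂ > θ₁`. -/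
theorem gadget_stays_off {N : ℕ} (A D : Fin N → Fin N → ℝ) {θ₁ θ₂ : ℝ} (hθ : θ₁ < θ₂)
    (σ₁ σ₂ : Equiv.Perm (Fin N))
    (h₁ : ∀ τ : Equiv.Perm (Fin N),
      ∑ i, A i (τ i) + θ₁ * ∑ i, D i (τ i) ≤ ∑ i, A i (σ₁ i) + θ₁ * ∑ i, D i (σ₁ i))
    (h₂ : ∀ τ : Equiv.Perm (Fin N),
      ∑ i, A i (τ i) + θ₂ * ∑ i, D i (τ i) ≤ ∑ i, A i (σ₂ i) + θ₂ * ∑ i, D i (σ₂ i))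
    (U : Finset (Fin N)) (hoff : ∀ i ∈ U, σ₁ i = i) (hon : ∀ i ∈ U, σ₂ i ∈ U)
    (hdec : ∑ i ∈ U, D i (σ₂ i) < ∑ i ∈ U, D i i) : False :=
  absurd (gadget_off_on A D hθ σ₁ σ₂ h₁ h₂ U hoff hon) (not_le.mpr hdec)

/-- **C2′ (block families are chains in the product order).**  If a row block `B` is mapped into itself by both optima
(`θ₁ < θ₂`), the slope mass on `B` is monotone: `∑_{B} D i (σ₁ i) ≤ ∑_{B} D i (σ₂ i)`.  Hence for a family acting blockwise on a
fixed partition `B₁ ⊔ … ⊔ B_t` the block-slope vectors of hull members are pairwise comparable coordinatewise (a chain in the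
product order), so at most `Σ_i (r_i − 1) + 1` of them are hull vertices (`r_i` = number of block-slope values in block `i`):
cyclic «Landau» orbit codes (`2^{Θ(√(N log N))}` members) and wreath-product codes collapse to `O(N)` / `O(N^{3/2})`. -/
theorem block_monotone {N : ℕ} (A D : Fin N → Fin N → ℝ) {θ₁ θ₂ : ℝ} (hθ : θ₁ < θ₂)
    (σ₁ σ₂ : Equiv.Perm (Fin N))
    (h₁ : ∀ τ : Equiv.Perm (Fin N),
      ∑ i, A i (τ i) + θ₁ * ∑ i, D i (τ i) ≤ ∑ i, A i (σ₁ i) + θ₁ * ∑ i, D i (σ₁ i))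
    (h₂ : ∀ τ : Equiv.Perm (Fin N),
      ∑ i, A i (τ i) + θ₂ * ∑ i, D i (τ i) ≤ ∑ i, A i (σ₂ i) + θ₂ * ∑ i, D i (σ₂ i))
    (B : Finset (Fin N)) (hB₁ : ∀ i ∈ B, σ₁ i ∈ B) (hB₂ : ∀ i ∈ B, σ₂ i ∈ B) :
    ∑ i ∈ B, D i (σ₁ i) ≤ ∑ i ∈ B, D i (σ₂ i) :=
  monotoneCycleLaw_holds _ A D _ _ hθ σ₁ σ₂ h₁ h₂ B (by rw [image_eq_of_mapsTo σ₁ B hB₁, image_eq_of_mapsTo σ₂ B hB₂])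

/-- Counting: an injective chain of subsets of a `k`-set indexed by `Fin n` has `n ≤ k + 1`. -/
theorem chain_count {n k : ℕ} (on : Fin n → Finset (Fin k))
    (hmono : ∀ j j' : Fin n, j < j' → on j ⊆ on j') (hinj : Function.Injective on) : n ≤ k + 1 := by
  classical
  have hsm : StrictMono (fun j => (on j).card) := by
    intro j j' hjj'
    exact Finset.card_lt_card
      (Finset.ssubset_iff_subset_ne.mpr ⟨hmono j j' hjj', fun h => (ne_of_lt hjj') (hinj h)⟩)
  have hle : ∀ j, (on j).card ≤ k := fun j => by
    simpa using Finset.card_le_univ (on j)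
  let f : Fin n → Fin (k + 1) := fun j => ⟨(on j).card, Nat.lt_succ_of_le (hle j)⟩
  have finj : Function.Injective f := by
    intro j j' h
    exact hsm.injective (by simpa [f] using congrArg Fin.val h)
  simpa using Fintype.card_le_of_injective f finj

/-- **C2 (products collapse to chains), counted.**  `n` optima `σ j` at strictly increasing parameters `θ j`; `k` gadgets
(row sets `U g`, not necessarily disjoint) inside each of which every `σ j` acts; every `σ j` is, on every gadget, either the
identity (OFF) or has positive slope increment (ON, `g ∈ on j`); members are determined by their ON-sets.  Then ON-sets form a
chain and `n ≤ k + 1`: the `2^k` on/off products contribute at most `k + 1` hull vertices. -/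
theorem products_collapse_to_chain {N n k : ℕ} (A D : Fin N → Fin N → ℝ) (θ : Fin n → ℝ) (hθ : StrictMono θ)
    (σ : Fin n → Equiv.Perm (Fin N))
    (hopt : ∀ (j : Fin n) (τ : Equiv.Perm (Fin N)),
      ∑ i, A i (τ i) + θ j * ∑ i, D i (τ i) ≤ ∑ i, A i (σ j i) + θ j * ∑ i, D i (σ j i))
    (U : Fin k → Finset (Fin N)) (hins : ∀ g j, ∀ i ∈ U g, σ j i ∈ U g)
    (on : Fin n → Finset (Fin k))
    (hon : ∀ j g, g ∈ on j → ∑ i ∈ U g, D i i < ∑ i ∈ U g, D i (σ j i))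
    (hoff : ∀ j g, g ∉ on j → ∀ i ∈ U g, σ j i = i)
    (hinj : Function.Injective on) : n ≤ k + 1 := by
  classical
  refine chain_count on ?_ hinj
  intro j j' hjj' g hg
  by_contra hg'
  exact gadget_stays_on A D (hθ hjj') (σ j) (σ j') (hopt j) (hopt j') (U g) (hins g j) (hon j g hg) (hoff j' g hg')

end MonotoneCycleLaw
end Summit.ValiantsHypothesis.ValiantsHypothesis.Theorems.LacunarySymmetroidMatrixDescartes
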